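import Mathlib.Analysis.InnerProductSpace.Positive
import Literature.Probability.LatticeModels.LatticeGraph
import Literature.Probability.LatticeModels.CorrelationDecay
import Literature.Probability.LatticeModels.GibbsSpecification
import Literature.Probability.LatticeModels.ONModel
import Literature.Probability.LatticeModels.ReflectionPositivity
import Literature.Probability.LatticeModels.TransferOperator
import Literature.Analysis.UnboundedOperators.SpectralGap
import HarnessLib
import HarnessLib.Audit

-- provenance: harness21/H21/H21/Statements/ConstructiveQFT/LatticeMassGap.lean @ 78ca55e (interim HEAD d8f2665); M5 mechanical rewrite
/-!
# Lattice mass gap: Euclidean clustering ⇔ Hamiltonian gap; the O(N) σ-model gap conjecture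
(family `constructive-qft`, trunk G02 StatMech, statements file)

This file states two inventory items of the `constructive-qft` family on top of the StatMech
prelude (transfer data / OS realisation `Literature.Probability.LatticeModels.TransferData`, `Literature.Probability.LatticeModels.IsOSRealisation`,
`Literature.Probability.LatticeModels.HasTimeClustering`; Gibbs specifications; the classical O(N) model).

* **constructive-qft.S10** (known theorem; Glimm–Jaffe 1987 §6.1 and §19; Osterwalder–Seiler
  1978 §2; Seiler LNP 159 Ch. 2; Lüscher 1977): for a measure `μ` with an Osterwalder–Schrader
  realisation `(H, ι, D)` (reflection `reflect`, unit time shift `shift`, positive-time σ-algebra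
  `m₊`, transfer operator `T = D.T`, vacuum `Ω = D.vacuum`), exponential clustering in the time
  direction with rate `m > 0` is equivalent to the mass gap `‖T|_{Ω^⊥}‖ ≤ e^{-m}`
  (`timeClustering_iff_massGap`), and its specialisation to lattice measures on `ℤ^d`
  (`latticeClustering_iff_gap`) with the time reflection between the hyperplanes `x₀ = -1` and
  `x₀ = 0`, the unit time shift and the positive-time cylinder σ-algebra `{x | 0 ≤ x₀}`.
  (i) Writing `T = e^{-H}` with `H ≥ 0`, `H Ω = 0`, the inventory's `inf (spec H ∖ {0}) ≥ m` is
  exactly `‖T|_{Ω^⊥}‖ ≤ e^{-m}`, i.e. `D.HasMassGap m`; the bridge to the operator-theoretic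
  vocabulary of the UnbddOp trunk (`ContinuousLinearMap.HasTransferGap`, whose spectral form is
  `ContinuousLinearMap.hasTransferGap_iff_spectrum`) is `TransferData.hasMassGap_iff_hasTransferGap`.
  (ii) **Deliberate weakening** (outline D5/R3): the inventory's *volume-uniform* clustering of
  finite-volume Schwinger functions is rendered as clustering of the single (infinite-volume or
  fixed) measure `μ` with `F, G`-dependent constants; with this reading both directions follow
  from the fields of `IsOSRealisation`, since `HasTimeClustering` is written with the same
  reflected OS bilinear form, so that the clustered quantity is `⟪ι F, (T P_{Ω^⊥})^t ι G⟫`.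
* **constructive-qft.S26** (flag / open conjecture; Polyakov 1975; Brézin–Zinn-Justin 1976;
  Simon's fifteen problems (1984); dissent: Patrascioiu–Seiler): the two-dimensional O(N)
  σ-model, `N ≥ 3`, has a unique Gibbs state with exponentially decaying two-point function at
  every `β > 0`. Stated as `def … : Prop` only (`ONSigmaModelMassGap`,
  `ONSigmaModelMassGapConjecture`). The known high-temperature counterpart (Dobrushin uniqueness)
  is the theorem `onTwoPoint_decay_high_temperature`.

## Mathlib / H21 search

Mathlib (pinned) has `MeasureTheory.cylinderEvents`, `measurable_cylinderEvents_iff`,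
`ContinuousLinearMap.IsPositive`, `Submodule.starProjection`, but no transfer matrix, OS
reconstruction, mass gap, Gibbs measure or O(N)-model vocabulary (searched `massGap`, `transfer`,
`Osterwalder`, `Gibbs`, `sigma model`). All notions used are from the accepted H21 preludes; the
only new definitions here are the concrete lattice time reflection / shift / positive half on
`ℤ^d = StatMech.Site d` (the torus versions live in `Literature.StatMech.Torus`, and wave 0 has the torus
`Literature.MathematicalPhysics.QuantumFieldTheory.Site.timeReflect`; to avoid the name clash `ConstructiveQFT.Site` (torus) vs
`StatMech.Site` (`ℤ^d`) recorded in the outline §0 we always write `StatMech.Site`).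

## Design choices

* The unit time shift is `latticeTimeShift d S σ x = σ (x + e₀)`, i.e. the *inverse* of
  `StatMech.configShift (Pi.single 0 1)` (`σ ↦ σ (· - e₀)`): with the OS convention
  `ι (G ∘ shift) = T (ι G)` an observable localised at times `≥ 0` must be sent to one localised
  at times `≥ 1 ⊆ {≥ 0}` (`measurable_latticeTimeShift`), which forces this sign.
* The time reflection is the reflection *between sites* `x₀ ↦ -1 - x₀`, exchanging the half
  spaces `{x₀ ≥ 0}` and `{x₀ ≤ -1}` (Osterwalder–Seiler 1978 §2, "link reflection"; FILS 1978).
* `ONSigmaModelMassGap N` carries `[NeZero N]` (needed by `onSpecification`); the conjecture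
  quantifies over `N ≥ 3` and manufactures the instance.

References: J. Glimm, A. Jaffe, *Quantum Physics* (2nd ed., 1987), §6.1, §19; K. Osterwalder,
E. Seiler, Ann. Phys. 110 (1978), §2; E. Seiler, LNP 159 (1982), Ch. 2; M. Lüscher, Comm. Math.
Phys. 54 (1977); A. M. Polyakov, Phys. Lett. B 59 (1975) 79; E. Brézin, J. Zinn-Justin, Phys.
Rev. B 14 (1976); B. Simon, *Fifteen problems in mathematical physics* (1984); A. Patrascioiu,
E. Seiler, math-ph/9903038; R. L. Dobrushin, Theory Probab. Appl. 13 (1968); H.-O. Georgii,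
*Gibbs Measures and Phase Transitions* (2011), Ch. 8; S. Friedli, Y. Velenik, *Statistical
Mechanics of Lattice Systems* (2017), §6.5, §9.
-/

open MeasureTheory
open scoped InnerProductSpace

namespace Literature.MathematicalPhysics.QuantumFieldTheory

open Literature.Probability.LatticeModels

/-! ### Bridge to the operator-theoretic transfer gap -/

section Bridge

variable {H : Type*} [NormedAddCommGroup H] [InnerProductSpace ℂ H] [CompleteSpace H]

/-- The mass gap of transfer data in the norm form `‖T ∘ P_{Ω^⊥}‖ ≤ e^{-m}`
(`TransferData.HasMassGap`) is equivalent to the quadratic-form version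
`re ⟪T x, x⟫ ≤ e^{-m} ‖x‖²` on `Ω^⊥` (`ContinuousLinearMap.HasTransferGap` of the UnbddOp
prelude), because `T` is positive, fixes `Ω`, hence leaves `Ω^⊥` invariant, and the norm of a
positive operator is the supremum of its quadratic form (Glimm–Jaffe 1987 §6.1, Thm. 6.1.3 ff.;
Reed–Simon I §VI.2). Combined with `ContinuousLinearMap.hasTransferGap_iff_spectrum` this is the
inventory's `inf (spec H ∖ {0}) ≥ m` for `T = e^{-H}`. [cite: GlimmJaffe1987, §6.1  Thm. 6.1.3 ff] -/
def _root_.Literature.Probability.LatticeModels.TransferData.hasMassGap_iff_hasTransferGap : Prop :=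
  ∀ (D : TransferData H) (m : ℝ),
    D.HasMassGap m ↔ D.T.HasTransferGap D.vacuum m

end Bridge

/-! ### constructive-qft.S10: Euclidean clustering ⇔ Hamiltonian gap -/

section Abstract

variable {Ω : Type*} [MeasurableSpace Ω] (μ : Measure Ω) [IsProbabilityMeasure μ]
  (reflect shift : Ω → Ω) (mpos : MeasurableSpace Ω)
  {H : Type*} [NormedAddCommGroup H] [InnerProductSpace ℂ H] [CompleteSpace H]
  (ι : (Ω → ℂ) → H) (D : TransferData H)

/-- **constructive-qft.S10** (Euclidean clustering ⇔ Hamiltonian gap; Glimm–Jaffe 1987 §6.1,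
Thm. 6.1.3 ff. and §19; Osterwalder–Seiler 1978 §2; Seiler LNP 159 Ch. 2; Lüscher 1977).
Let `(H, ι, D)` be an Osterwalder–Schrader realisation of the probability measure `μ` with time
reflection `reflect`, unit time shift `shift` and positive-time σ-algebra `m₊`, with transfer
operator `T = e^{-H} ≥ 0` and vacuum `Ω`. Then for `m > 0`, exponential clustering in the time
direction with rate `m`,
`|∫ conj (F ∘ reflect) · (G ∘ shift^t) dμ - (∫ conj (F ∘ reflect) dμ)(∫ G dμ)| ≤ C_{F,G} e^{-m t}`
for all bounded `m₊`-measurable `F, G`, is equivalent to the mass gap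
`‖T|_{Ω^⊥}‖ ≤ e^{-m}`, i.e. `inf (spec H ∖ {0}) ≥ m` (see
`TransferData.hasMassGap_iff_hasTransferGap`, `ContinuousLinearMap.hasTransferGap_iff_spectrum`).
*Weakening recorded:* the inventory asks for clustering *uniform in the volume* of finite-volume
Schwinger functions; here clustering is that of the single measure `μ` with `F, G`-dependent
constants (outline D5/R3). Proof sketch: `⇐` is
`IsOSRealisation.hasTimeClustering_of_hasMassGap`; for `⇒`, with `A = T P_{Ω^⊥}` (a positive
contraction of `Ω^⊥`) clustering with `F = G` bounds `⟪v, A^t v⟫ ≤ C_v e^{-m t}` for `v` in the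
dense set `P_{Ω^⊥} (ι F)`, so the spectral measure of each such `v` lives on `[0, e^{-m}]`, a
closed condition, whence `‖A‖ ≤ e^{-m}`. [cite: GlimmJaffe1987, §6.1  Thm. 6.1.3 ff. and §19] -/
def timeClustering_iff_massGap : Prop :=
  ∀ (hOS : IsOSRealisation μ reflect shift mpos ι D) (m : ℝ) (hm : 0 < m),
    HasTimeClustering μ reflect shift mpos m ↔ D.HasMassGap m

end Abstract

/-! ### Lattice specialisation on `ℤ^d` -/

section Lattice

variable (d : ℕ) [NeZero d] (S : Type*) [MeasurableSpace S]

/-- The **time reflection between sites** of `ℤ^d`: `x₀ ↦ -1 - x₀`, other coordinates fixed; it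
is the reflection in the hyperplane `x₀ = -1/2` bisecting the time-like bonds `{-1, 0} + ℤ^{d-1}`
and exchanges `{x₀ ≥ 0}` with `{x₀ ≤ -1}` (Osterwalder–Seiler 1978 §2; Fröhlich–Israel–Lieb–Simon
1978 §2, reflection "through bonds"). Time is the coordinate `0 : Fin d` (`[NeZero d]`). [cite: OsterwalderSeiler1978, §2] -/
def latticeTimeReflection : Literature.Probability.LatticeModels.Site d ≃ Literature.Probability.LatticeModels.Site d where
  toFun x := Function.update x 0 (-1 - x 0)
  invFun x := Function.update x 0 (-1 - x 0)
  left_inv x := by ext j; by_cases h : j = 0 <;> simp [h]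
  right_inv x := by ext j; by_cases h : j = 0 <;> simp [h]

/-- Pointwise formula for the lattice time reflection (Osterwalder–Seiler 1978 §2). [cite: OsterwalderSeiler1978, §2] -/
@[simp]
theorem latticeTimeReflection_apply (x : Literature.Probability.LatticeModels.Site d) :
    latticeTimeReflection d x = Function.update x 0 (-1 - x 0) := rfl

/-- The lattice time reflection is an involution, `θ² = id` (Osterwalder–Seiler 1978 §2). [cite: OsterwalderSeiler1978, §2] -/
theorem latticeTimeReflection_involutive : Function.Involutive (latticeTimeReflection d) :=
  (latticeTimeReflection d).left_inv

/-- The **positive-time half** `{x ∈ ℤ^d | 0 ≤ x₀}` of the lattice (Osterwalder–Seiler 1978 §2,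
`Λ₊`; Glimm–Jaffe 1987 §6.1). [cite: OsterwalderSeiler1978, §2   Λ₊] -/
def positiveTimeSites : Set (Literature.Probability.LatticeModels.Site d) := {x | 0 ≤ x 0}

/-- The time reflection maps the positive-time half onto its complement `{x₀ ≤ -1}`
(Osterwalder–Seiler 1978 §2: `θ Λ₊ = Λ₋`, `Λ₊ ∩ Λ₋ = ∅` for the reflection between sites). [cite: OsterwalderSeiler1978, §2:  θ Λ₊ = Λ₋    Λ₊ ∩ Λ₋ = ∅  for the r] -/
theorem latticeTimeReflection_image_positiveTimeSites :
    latticeTimeReflection d '' positiveTimeSites d = (positiveTimeSites d)ᶜ := by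
  rw [Equiv.image_eq_preimage_symm]
  ext x
  simp only [positiveTimeSites, Set.mem_preimage, Set.mem_setOf_eq, Set.mem_compl_iff]
  change 0 ≤ Function.update x 0 (-1 - x 0) 0 ↔ ¬ 0 ≤ x 0
  simp only [Function.update_self]
  omega

/-- The **positive-time σ-algebra** on configurations `ℤ^d → S`: the cylinder events of the
half `{0 ≤ x₀}`, `StatMech.positiveEvents (positiveTimeSites d)` = Mathlib's
`MeasureTheory.cylinderEvents` (Osterwalder–Seiler 1978 §2; Glimm–Jaffe 1987 §6.1, `𝓔₊`). [cite: OsterwalderSeiler1978, §2] -/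
abbrev positiveTimeEvents : MeasurableSpace (Literature.Probability.LatticeModels.Site d → S) :=
  positiveEvents (S := S) (positiveTimeSites d)

/-- The **unit time shift** of configurations on `ℤ^d`, `(latticeTimeShift d S σ) x = σ (x + e₀)`,
as a measurable equivalence; it is the inverse of `StatMech.configShift (Pi.single 0 1)`. With the
OS convention `ι (G ∘ shift) = T (ι G)` this is the sign for which observables localised at
times `≥ 0` are shifted to observables localised at times `≥ 1` (Glimm–Jaffe 1987 §6.1,
`T(t)`; Osterwalder–Seiler 1978 §2). [cite: GlimmJaffe1987, §6.1   T(t] -/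
def latticeTimeShift : (Literature.Probability.LatticeModels.Site d → S) ≃ᵐ (Literature.Probability.LatticeModels.Site d → S) :=
  (configShift (Pi.single 0 1)).symm

/-- `latticeTimeShift d S σ x = σ (x + e₀)` (Glimm–Jaffe 1987 §6.1). [cite: GlimmJaffe1987, §6.1] -/
@[simp]
theorem latticeTimeShift_apply (σ' : Literature.Probability.LatticeModels.Site d → S) (x : Literature.Probability.LatticeModels.Site d) :
    latticeTimeShift d S σ' x = σ' (x + Pi.single 0 1) := rfl

/-- The unit time shift maps positive-time events to positive-time events: it is measurable from
`positiveTimeEvents` to itself, since `x₀ ≥ 0 → x₀ + 1 ≥ 0` (Glimm–Jaffe 1987 §6.1: `T(t)`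
leaves `𝓔₊` invariant for `t ≥ 0`). This is the field `measurable_comp_shift` of
`StatMech.IsOSRealisation` for the lattice data. [cite: GlimmJaffe1987, §6.1:  T(t] -/
theorem measurable_latticeTimeShift :
    Measurable[positiveTimeEvents d S, positiveTimeEvents d S] (latticeTimeShift d S) := by
  rw [measurable_cylinderEvents_iff]
  intro x hx
  have hx' : x + Pi.single 0 1 ∈ positiveTimeSites d := by
    simp only [positiveTimeSites, Set.mem_setOf_eq, Pi.add_apply, Pi.single_eq_same] at hx ⊢
    omega
  simpa using measurable_cylinderEvent_apply (X := fun _ : Literature.Probability.LatticeModels.Site d => S) hx'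

/-- Consequently `G ↦ G ∘ latticeTimeShift` preserves `positiveTimeEvents`-measurability of
complex observables (Glimm–Jaffe 1987 §6.1). [cite: GlimmJaffe1987, §6.1] -/
theorem measurable_comp_latticeTimeShift {G : (Literature.Probability.LatticeModels.Site d → S) → ℂ}
    (hG : Measurable[positiveTimeEvents d S] G) :
    Measurable[positiveTimeEvents d S] (G ∘ latticeTimeShift d S) :=
  @Measurable.comp _ _ _ (positiveTimeEvents d S) (positiveTimeEvents d S) _ _ _ hG
    (measurable_latticeTimeShift d S)

variable {d S}
variable {H : Type*} [NormedAddCommGroup H] [InnerProductSpace ℂ H] [CompleteSpace H]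

/-- **constructive-qft.S10** (lattice form; Osterwalder–Seiler 1978 §2; Seiler LNP 159 Ch. 2;
Glimm–Jaffe 1987 §19): for a probability measure `μ` on configurations `ℤ^d → S` whose
Osterwalder–Schrader reconstruction with respect to the time reflection between sites
`latticeTimeReflection d`, the unit time shift `latticeTimeShift d S` and the positive-time
σ-algebra `positiveTimeEvents d S` is realised by `(H, ι, D)`, exponential clustering of `μ` in
the time direction with rate `m > 0` is equivalent to the mass gap `‖T|_{Ω^⊥}‖ ≤ e^{-m}` of the
transfer operator. (Same weakening as `timeClustering_iff_massGap`: clustering of the fixed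
measure `μ`, not volume-uniform clustering.) [cite: OsterwalderSeiler1978, §2] -/
def latticeClustering_iff_gap : Prop :=
  ∀ (μ : Measure (Literature.Probability.LatticeModels.Site d → S)) [IsProbabilityMeasure μ] (ι : ((Literature.Probability.LatticeModels.Site d → S) → ℂ) → H) (D : TransferData H) (hOS : IsOSRealisation μ (configReflect (latticeTimeReflection d)) (latticeTimeShift d S) (positiveTimeEvents d S) ι D) (m : ℝ) (hm : 0 < m),
    HasTimeClustering μ (configReflect (latticeTimeReflection d)) (latticeTimeShift d S)
      (positiveTimeEvents d S) m ↔ D.HasMassGap m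

/- interim proof relied on results that are now named facts (D-0014); demoted to a fact by the M5 import, proof preserved:
:=
  timeClustering_iff_massGap μ _ _ _ ι D hOS m hm
-/

end Lattice

/-! ### constructive-qft.S26: the O(N) σ-model mass gap conjecture -/

section ONModel

/-- The **mass-gap property of the two-dimensional O(N) σ-model** at all temperatures: for
every `β > 0` the nearest-neighbour O(N) model on `ℤ²` (spins in `S^{N-1}`, weight
`exp (β Σ s_x · s_y)`, specification `StatMech.onSpecification (zdGraph 2) β`) has a unique
infinite-volume Gibbs measure, and the two-point function `⟨s_0 · s_x⟩_μ` of every (i.e. of the)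
Gibbs measure `μ` decays exponentially in `x` (finite correlation length `ξ(β) < ∞`)
(Polyakov, Phys. Lett. B 59 (1975); Brézin–Zinn-Justin, Phys. Rev. B 14 (1976); Simon,
*Fifteen problems* (1984)). This is a `Prop`; see `ONSigmaModelMassGapConjecture`. [folklore] -/
def ONSigmaModelMassGap (N : ℕ) [NeZero N] : Prop :=
  ∀ β : ℝ, 0 < β →
    HasUniqueGibbsMeasure (onSpecification (V := Literature.Probability.LatticeModels.Site 2) (N := N) (zdGraph 2) β) ∧
      ∀ μ ∈ onGibbsMeasures 2 N β,
        HasExponentialDecay (fun x : Literature.Probability.LatticeModels.Site 2 => onTwoPoint μ 0 x)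

/-- **constructive-qft.S26** (flag / OPEN conjecture; Polyakov 1975; Brézin–Zinn-Justin 1976;
Simon, *Fifteen problems in mathematical physics* (1984); `1/N` evidence: Kupiainen, Comm. Math.
Phys. 73 (1980)): for every `N ≥ 3` the two-dimensional O(N) σ-model has a mass gap at all
`β > 0` (`ONSigmaModelMassGap N`). This is asymptotic freedom of the 2-D non-abelian σ-model and
is open; Patrascioiu–Seiler (math-ph/9903038 and sequels) have argued for the *opposite*
(a finite-`β` transition with power-law decay), so the statement is recorded as a definition
only, never asserted. (For `N = 2` it is false by the Kosterlitz–Thouless transition,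
Fröhlich–Spencer 1981; for `N = 1` by the Ising transition.) [cite: FrohlichSpencer1981] -/
@[conjecture] def ONSigmaModelMassGapConjecture : Prop :=
  ∀ N : ℕ, ∀ _h : 3 ≤ N, ∀ [NeZero N], ONSigmaModelMassGap N

/-- **High-temperature mass gap of the O(N) model** (known theorem; Dobrushin, Theory Probab.
Appl. 13 (1968); Georgii 2011, Ch. 8, Thm. 8.7 with Example 8.11 and Cor. 8.32; Friedli–Velenik
2017, §6.5.2): for every `N ≥ 1` and dimension `d` there is `β₀ > 0` such that for
`0 < β < β₀` the O(N) model on `ℤ^d` has a unique Gibbs measure whose two-point function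
`⟨s_0 · s_x⟩` decays exponentially. [cite: Georgii2011, Ch. 8  Thm. 8.7 with Example 8.11 and Co] -/
def onTwoPoint_decay_high_temperature : Prop :=
  ∀ (d N : ℕ) [NeZero N],
    ∃ β₀ > 0, ∀ β ∈ Set.Ioo 0 β₀,
      HasUniqueGibbsMeasure (onSpecification (V := Literature.Probability.LatticeModels.Site d) (N := N) (zdGraph d) β) ∧
        ∀ μ ∈ onGibbsMeasures d N β,
          HasExponentialDecay (fun x : Literature.Probability.LatticeModels.Site d => onTwoPoint μ 0 x)

end ONModel

/-! ### Proof of the bridge `TransferData.hasMassGap_iff_hasTransferGap`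

Glimm–Jaffe 1987, §6.1, Theorem 6.1.3 and the Remark "Transfer matrix of statistical physics":
the transfer matrix is a hermitian contraction `0 ≤ K ≤ I` with `K Ω = Ω`. The norm form
`‖K P_{Ω^⊥}‖ ≤ e^{-m}` (`TransferData.HasMassGap`) and the quadratic-form form
`re ⟪K x, x⟫ ≤ e^{-m} ‖x‖²` on `Ω^⊥` (`ContinuousLinearMap.HasTransferGap`) agree because the norm
of a hermitian operator is the supremum of its quadratic form on unit vectors (Conway 1985,
Ch. II, Prop. 2.13, by polarization), applied to `K P_{Ω^⊥} = P_{Ω^⊥} K P_{Ω^⊥}` (hermitian since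
`K` is symmetric and fixes `Ω`, `TransferData.map_mem_vacuumLine_orthogonal`). -/

section BridgeProof

variable {H : Type*} [NormedAddCommGroup H] [InnerProductSpace ℂ H] [CompleteSpace H]

omit [CompleteSpace H] in
/-- **Polarization bound** (Conway 1985, Ch. II, Proposition 2.13, the inequality
`4 re ⟪A h, g⟫ = ⟪A (h + g), h + g⟫ - ⟪A (h - g), h - g⟫ ≤ M (‖h + g‖² + ‖h - g‖²) = 4M` of its
proof): a bounded operator `S` whose quadratic form is real-symmetric
(`re ⟪S y, x⟫ = re ⟪S x, y⟫`) and takes values in `[0, c ‖z‖²]` has operator norm at most `c`.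
(This is the argument of Mathlib's `ContinuousLinearMap.norm_eq_iSup_rayleighQuotient`, with the
supremum replaced by the a-priori bound `c`.) [cite: Conway1985, Ch. II  Prop. 2.13] -/
theorem opNorm_le_of_re_inner_self_le (S : H →L[ℂ] H) {c : ℝ} (hc : 0 ≤ c)
    (hsymm : ∀ x y : H, RCLike.re ⟪S y, x⟫_ℂ = RCLike.re ⟪S x, y⟫_ℂ)
    (hnonneg : ∀ z : H, 0 ≤ RCLike.re ⟪S z, z⟫_ℂ)
    (hle : ∀ z : H, RCLike.re ⟪S z, z⟫_ℂ ≤ c * ‖z‖ ^ 2) : ‖S‖ ≤ c := by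
  refine ContinuousLinearMap.opNorm_le_of_re_inner_le hc fun x y hx hy => ?_
  have h1 := hle (x + y)
  have h2 := hnonneg (x - y)
  have e1 : RCLike.re ⟪S (x + y), x + y⟫_ℂ - RCLike.re ⟪S (x - y), x - y⟫_ℂ =
      4 * RCLike.re ⟪S x, y⟫_ℂ := by
    simp only [map_add, map_sub, inner_add_left, inner_add_right, inner_sub_left,
      inner_sub_right, hsymm x y]
    ring
  have hpar : ‖x + y‖ ^ 2 + ‖x - y‖ ^ 2 = 4 := by
    rw [parallelogram_law_with_norm ℂ x y, hx, hy]; norm_num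
  have h3 : ‖x + y‖ ^ 2 ≤ 4 := by nlinarith [sq_nonneg ‖x - y‖]
  have h4 : c * ‖x + y‖ ^ 2 ≤ c * 4 := mul_le_mul_of_nonneg_left h3 hc
  linarith

omit [CompleteSpace H] in
/-- Matrix elements of `T ∘ P_{Ω^⊥}` for transfer data: since `T` is symmetric and fixes `Ω`, it
maps `Ω^⊥` into itself (`TransferData.map_mem_vacuumLine_orthogonal`), so
`⟪T P u, v⟫ = ⟪T P u, P v⟫`, i.e. `T P_{Ω^⊥} = P_{Ω^⊥} T P_{Ω^⊥}` weakly
(Glimm–Jaffe 1987 §6.1, Theorem 6.1.3 and Remark: `K = K^*`, `K Ω = Ω`). [cite: GlimmJaffe1987, §6.1  Theorem 6.1.3] -/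
theorem _root_.Literature.Probability.LatticeModels.TransferData.inner_comp_starProjection_apply
    (D : TransferData H) [(D.vacuumLine)ᗮ.HasOrthogonalProjection] (u v : H) :
    ⟪(D.T ∘L (D.vacuumLine)ᗮ.starProjection) u, v⟫_ℂ =
      ⟪D.T ((D.vacuumLine)ᗮ.starProjection u), (D.vacuumLine)ᗮ.starProjection v⟫_ℂ := by
  have hmem : D.T ((D.vacuumLine)ᗮ.starProjection u) ∈ (D.vacuumLine)ᗮ :=
    D.map_mem_vacuumLine_orthogonal (Submodule.starProjection_apply_mem _ u)
  have h0 : ⟪D.T ((D.vacuumLine)ᗮ.starProjection u), v - (D.vacuumLine)ᗮ.starProjection v⟫_ℂ = 0 :=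
    Submodule.inner_right_of_mem_orthogonal hmem (Submodule.sub_starProjection_mem_orthogonal v)
  rw [ContinuousLinearMap.comp_apply, ← sub_eq_zero, ← inner_sub_right, h0]

/-- **Quadratic-form bound ⇒ norm bound** for transfer data: if `re ⟪T x, x⟫ ≤ c ‖x‖²` for all
`x ⊥ Ω` (with `0 ≤ c`), then `gapNorm = ‖T ∘ P_{Ω^⊥}‖ ≤ c`. Indeed `S = T P_{Ω^⊥}` has the
real-symmetric quadratic form `re ⟪S z, z⟫ = re ⟪T P z, P z⟫ ∈ [0, c ‖P z‖²] ⊆ [0, c ‖z‖²]`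
(`T ≥ 0`), and the norm of a hermitian operator is the supremum of its quadratic form
(Glimm–Jaffe 1987 §6.1, Theorem 6.1.3 ff.: `0 ≤ K ≤ I`, `K Ω = Ω`; Conway 1985, Ch. II,
Prop. 2.13). [cite: GlimmJaffe1987, §6.1  Theorem 6.1.3] -/
theorem _root_.Literature.Probability.LatticeModels.TransferData.gapNorm_le_of_re_inner_le
    (D : TransferData H) {c : ℝ} (hc : 0 ≤ c)
    (h : ∀ x ∈ (D.vacuumLine)ᗮ, RCLike.re ⟪D.T x, x⟫_ℂ ≤ c * ‖x‖ ^ 2) : D.gapNorm ≤ c := by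
  refine opNorm_le_of_re_inner_self_le _ hc (fun x y => ?_) (fun z => ?_) (fun z => ?_)
  · rw [D.inner_comp_starProjection_apply, D.inner_comp_starProjection_apply,
      D.isPositive.inner_left_eq_inner_right, ← inner_conj_symm, RCLike.conj_re]
  · rw [D.inner_comp_starProjection_apply]
    exact D.isPositive.re_inner_nonneg_left _
  · rw [D.inner_comp_starProjection_apply]
    calc RCLike.re ⟪D.T ((D.vacuumLine)ᗮ.starProjection z), (D.vacuumLine)ᗮ.starProjection z⟫_ℂ
        ≤ c * ‖(D.vacuumLine)ᗮ.starProjection z‖ ^ 2 :=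
          h _ (Submodule.starProjection_apply_mem _ z)
      _ ≤ c * ‖z‖ ^ 2 := by
          gcongr
          exact Submodule.norm_starProjection_apply_le _ z

/-- **Norm bound ⇒ quadratic-form bound** for transfer data: if `gapNorm = ‖T ∘ P_{Ω^⊥}‖ ≤ c`
then `re ⟪T x, x⟫ ≤ c ‖x‖²` for all `x ⊥ Ω`, by the Schwarz inequality and `P_{Ω^⊥} x = x`
(Glimm–Jaffe 1987 §6.1, Theorem 6.1.3 ff.; Conway 1985, Ch. II, Prop. 2.13, the easy half
`M ≤ ‖A‖`). [cite: GlimmJaffe1987, §6.1  Theorem 6.1.3] -/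
theorem _root_.Literature.Probability.LatticeModels.TransferData.re_inner_le_of_gapNorm_le
    (D : TransferData H) {c : ℝ} (h : D.gapNorm ≤ c) {x : H} (hx : x ∈ (D.vacuumLine)ᗮ) :
    RCLike.re ⟪D.T x, x⟫_ℂ ≤ c * ‖x‖ ^ 2 := by
  have hPx : (D.vacuumLine)ᗮ.starProjection x = x := Submodule.starProjection_eq_self_iff.mpr hx
  have hTx : ‖D.T x‖ ≤ D.gapNorm * ‖x‖ := by
    have := (D.T ∘L (D.vacuumLine)ᗮ.starProjection).le_opNorm x
    rwa [ContinuousLinearMap.comp_apply, hPx] at this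
  calc RCLike.re ⟪D.T x, x⟫_ℂ ≤ ‖⟪D.T x, x⟫_ℂ‖ := RCLike.re_le_norm _
    _ ≤ ‖D.T x‖ * ‖x‖ := norm_inner_le_norm _ _
    _ ≤ D.gapNorm * ‖x‖ * ‖x‖ := mul_le_mul_of_nonneg_right hTx (norm_nonneg _)
    _ ≤ c * ‖x‖ * ‖x‖ := by gcongr
    _ = c * ‖x‖ ^ 2 := by ring

/-- **Discharge of `TransferData.hasMassGap_iff_hasTransferGap`** (Glimm–Jaffe 1987 §6.1,
Theorem 6.1.3 and the Remark "Transfer matrix of statistical physics": `0 ≤ K ≤ I`, `K = K^*`,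
`K Ω = Ω`; Conway 1985, Ch. II, Prop. 2.13: `‖A‖ = sup {|⟪A h, h⟫| : ‖h‖ = 1}` for hermitian
`A`): for transfer data `D = (T, Ω)` and `m : ℝ`, `D.HasMassGap m` (`0 < m ∧ ‖T P_{Ω^⊥}‖ ≤ e^{-m}`)
iff `D.T.HasTransferGap D.vacuum m`
(`T ≥ 0 ∧ Ω ≠ 0 ∧ T Ω = Ω ∧ 0 < m ∧ ∀ x ⊥ Ω, re ⟪T x, x⟫ ≤ e^{-m} ‖x‖²`).
`⇒`: `TransferData.re_inner_le_of_gapNorm_le` (Schwarz inequality, `P_{Ω^⊥} x = x`); `T ≥ 0`,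
`Ω ≠ 0` (as `‖Ω‖ = 1`) and `T Ω = Ω` are fields of `TransferData`.
`⇐`: `TransferData.gapNorm_le_of_re_inner_le` (polarization for the hermitian `T P_{Ω^⊥}`). [cite: GlimmJaffe1987, §6.1  Theorem 6.1.3 ff] -/
theorem _root_.Literature.Probability.LatticeModels.TransferData.hasMassGap_iff_hasTransferGap_holds :
    TransferData.hasMassGap_iff_hasTransferGap (H := H) := by
  intro D m
  have hΩ : D.vacuum ≠ 0 := by
    rw [← norm_ne_zero_iff, D.norm_vacuum]
    exact one_ne_zero
  constructor
  · rintro ⟨hm, hgap⟩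
    exact ⟨D.isPositive, hΩ, D.map_vacuum, hm, fun x hx => D.re_inner_le_of_gapNorm_le hgap hx⟩
  · rintro ⟨-, -, -, hm, h⟩
    exact ⟨hm, D.gapNorm_le_of_re_inner_le (Real.exp_pos _).le h⟩

end BridgeProof

end Literature.MathematicalPhysics.QuantumFieldTheory
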